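import Summits.Schanuel.Schanuel.Theorems.RootDecomp1KSiegelFunctionsAll03

/-!
# RootDecomp1KSiegelFunctionsAll (part 04) — CENSUS PROVENANCE for lens-1 g71 ADDENDUM 31-G «GEOMETRIC IRREDUCIBILITY DROPPED: the Gauss bridge by primality» (NOTE L3206 / ACK L3207; ×0, no claim, no price; after RESULT/DONE L3202)

(census-1 g26 record port, ×0 addendum to the node-31-G port RootDecomp1KSiegelFunctionsAll01–03 (p850868 · p850878 · p850884; PORT LANDED 31-G L3205). SOURCE: the lens's portG/RootDecomp1KSiegelFunctionsAll04.lean sha256 7fbdc151fe0d… (169 l; section PrimeAll over out/SiegelFunctionsAll.lean; lens farm rc 0 / 0 sorries over the TREE part All03, p4.json 8239a230…), body VERBATIM, this provenance block added; chain 04 ← 03; ONE namespace Summit.Schanuel.Schanuel.Theorems.RootDecomp1KSiegelFunctions; `--supports stmt-Schanuel-33364` (item OPEN). CONTENT (11 + 1 decls): the GAUSS BRIDGE BY PRIMALITY `irreducible_ratModel_of_prime : Prime P → 1 ≤ P.natDegree → Irreducible (ratModel P)` (denominators cleared; the cofactor divides a nonzero constant), hence for EVERY PRIME P with xdeg P,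 deg_Y P ≥ 1: `siegelModel_nonempty_of_prime`, `siegelFunctions_of_prime`, `heightComparisonAt_of_prime : Prime P → 1 ≤ xdeg P → 1 ≤ P.natDegree → HeightComparisonAt P` (node 12's comparison WITHOUT GeomIrreducible — K's part 04 used geometric irreducibility only through `irreducible_ratModel_of_geomIrreducible`), `thinFibreAt_of_prime_lt` (THEOREM A for every prime), the K-line head with the residual shrunk to the height boundary `thinFibre_of_padicSubspace_offDeg : 2 ≤ m₀ → PadicSubspace → HeightOffDegAt m₀ → ThinFibre m₀` with `def HeightOffDegAt m₀` (the Siegel clause demanded only for primes off DecidedAt m₀ / SepTopAt m₀ with m₀·xdeg P ≤ deg_Y P; `heightOffDegAt_of_heightOffAt`), `b_of_padicSubspace_offDeg`. Nothing here proves Schanuel, 33364, 33363, 31077 or 31987; rung 0; ×0 (RULE K-R59 (iii)).)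
-/

/-!
# RootDecomp1KSiegelFunctionsAll04 — lens 1, generation 71, ADDENDUM to NODE 31-G «GEOMETRIC IRREDUCIBILITY DROPPED»
(HOME decomp-schanuel-lens-1/g71/out/PrimeAll.lean; memo NODE-g71.md §5): a GAUSS BRIDGE BY PRIMALITY
(`irreducible_ratModel_of_prime : Prime P → 1 ≤ deg_Y P → Irreducible (ratModel P)` — clear the denominators of a
factorisation over `ℚ`, use `Prime P` in `ℤ[x][Y]`, the cofactor divides a nonzero constant), hence for EVERY PRIME `P`
with `xdeg P, deg_Y P ≥ 1`: a function-field model (`siegelModel_nonempty_of_prime`), Siegel functions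
(`siegelFunctions_of_prime`), **the height comparison `heightComparisonAt_of_prime`** (node 12's binder AT `P`, no
`GeomIrreducible`), node 12's THEOREM A for every prime (`thinFibreAt_of_prime_lt`), and the K-line sector head with the
residual shrunk to the primes ON OR ABOVE the height boundary `m₀ · xdeg P ≤ deg_Y P`:
`thinFibre_of_padicSubspace_offDeg : 2 ≤ m₀ → PadicSubspace → HeightOffDegAt m₀ → ThinFibre m₀`
(`heightOffDegAt_of_heightOffAt : HeightOffAt m₀ → HeightOffDegAt m₀`).  ONE namespace
`Summit.Schanuel.Schanuel.Theorems.RootDecomp1KSiegelFunctions`; on top of parts `…SiegelFunctionsAll01–03`.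
-/

noncomputable section

namespace Summit.Schanuel.Schanuel.Theorems.RootDecomp1KSiegelFunctions

open Polynomial
open scoped Nat
open Summit.Schanuel.Schanuel.Theorems.RootDecomp1KDegreeLadder (bev xdeg natDegree_coeff_le_xdeg ThinFibreAt ThinFibre
  thinFibreAt_of_natDegree_lt)
open Summit.Schanuel.Schanuel.Theorems.RootDecomp1KHeightGrading
open scoped IntermediateField

/-! ### GI DROPPED (decomp-schanuel-lens-1 g71, scratch over the standalone): a GAUSS BRIDGE BY PRIMALITY
(`Prime P ⇒ ratModel P` irreducible), hence a function-field model, Siegel functions and THE HEIGHT COMPARISON for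
EVERY PRIME `P` (no geometric irreducibility), node 12's THEOREM A for every prime, and the K-line sector head with the
residual shrunk to `m₀ · xdeg P ≤ deg_Y P`. -/
section PrimeAll

open Literature.NumberTheory.DiophantineGeometry
open Literature.NumberTheory.DiophantineGeometry.AlgFunctionField
open Summit.Schanuel.Schanuel.Theorems.RootDecomp1KLevelFinite (SiegelClause DecidedAt levelFinite_of_siegelClause
  thinFibreAt_of_levelFinite thinFibre_of_prime thinFibreAt_of_decidedAt)
open Summit.Schanuel.Schanuel.Theorems.RootDecomp1KSubspaceBranch (PadicSubspace SepTopAt thinFibreAt_of_sepTopAt)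

/-- `ratModel` is injective. -/
theorem ratModel_injective : Function.Injective (ratModel : ℤ[X][X] → ℚ[X][X]) := fun _ _ h =>
  map_injective _ (map_injective _ (RingHom.injective_int _)) h

/-- a divisor of a nonzero constant `C (C c)` in `ℤ[x][Y]` is a constant `C (C e)`, `e ≠ 0`. -/
theorem eq_C_C_of_mul_eq_C_C {T B : ℤ[X][X]} {c : ℤ} (hc : c ≠ 0) (h : T * B = C (C c)) :
    ∃ e : ℤ, e ≠ 0 ∧ B = C (C e) := by
  have hCc : (C (C c) : ℤ[X][X]) ≠ 0 := by simpa using hc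
  have hT0 : T ≠ 0 := by rintro rfl; exact hCc (by rw [← h, zero_mul])
  have hB0 : B ≠ 0 := by rintro rfl; exact hCc (by rw [← h, mul_zero])
  have hdeg : T.natDegree + B.natDegree = 0 := by rw [← natDegree_mul hT0 hB0, h, natDegree_C]
  have hB : B = C (B.coeff 0) := eq_C_of_natDegree_eq_zero (by omega)
  have hT : T = C (T.coeff 0) := eq_C_of_natDegree_eq_zero (by omega)
  have h' : T.coeff 0 * B.coeff 0 = C c := by
    have := h; rw [hB, hT, ← C_mul] at this; exact C_inj.1 this
  have ht0 : T.coeff 0 ≠ 0 := by intro h0; rw [h0, zero_mul] at h'; exact (by simpa using hc : (C c : ℤ[X]) ≠ 0) h'.symm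
  have hb0 : B.coeff 0 ≠ 0 := by intro h0; rw [h0, mul_zero] at h'; exact (by simpa using hc : (C c : ℤ[X]) ≠ 0) h'.symm
  have hdeg' : (T.coeff 0).natDegree + (B.coeff 0).natDegree = 0 := by rw [← natDegree_mul ht0 hb0, h', natDegree_C]
  have hb : B.coeff 0 = C ((B.coeff 0).coeff 0) := eq_C_of_natDegree_eq_zero (by omega)
  refine ⟨(B.coeff 0).coeff 0, fun h0 => hb0 (by rw [hb, h0, C_0]), by rw [← hb]; exact hB⟩

/-- **GAUSS BRIDGE BY PRIMALITY**: a prime of `ℤ[x][Y]` of `Y`-degree `≥ 1` is irreducible in `ℚ[x][Y]`. -/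
theorem irreducible_ratModel_of_prime {P : ℤ[X][X]} (hP : Prime P) (hn : 1 ≤ P.natDegree) :
    Irreducible (ratModel P) := by
  classical
  refine irreducible_iff.2 ⟨fun hu => ?_, fun A B hAB => ?_⟩
  · have h0 := natDegree_eq_zero_of_isUnit hu
    rw [natDegree_ratModel] at h0
    omega
  obtain ⟨a, AZ, ha, hA⟩ := exists_ratModel_eq_C_mul A
  obtain ⟨b, BZ, hb, hB⟩ := exists_ratModel_eq_C_mul B
  have hprod : AZ * BZ = C (C (a * b)) * P := by
    apply ratModel_injective
    rw [ratModel_mul, hA, hB, ratModel_mul, ratModel_C_C, hAB, Int.cast_mul, C_mul, C_mul]; ring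
  have hab : a * b ≠ 0 := mul_ne_zero ha hb
  have hdvd : P ∣ AZ * BZ := ⟨C (C (a * b)), by rw [hprod, mul_comm]⟩
  -- the factor NOT divisible by `P` divides the constant, hence is a unit over `ℚ`
  have key : ∀ {V : ℚ[X][X]} {UZ VZ : ℤ[X][X]} {v : ℤ}, v ≠ 0 → ratModel VZ = C (C (v : ℚ)) * V →
      UZ * VZ = C (C (a * b)) * P → P ∣ UZ → IsUnit V := by
    intro V UZ VZ v hv hV hUV ⟨T, hT⟩
    have h1 : P * (T * VZ) = P * C (C (a * b)) := by rw [← mul_assoc, ← hT, hUV, mul_comm]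
    have h2 : T * VZ = C (C (a * b)) := mul_left_cancel₀ hP.ne_zero h1
    obtain ⟨e, he, hVZ⟩ := eq_C_C_of_mul_eq_C_C hab h2
    have h3 : C (C (v : ℚ)) * V = C (C (e : ℚ)) := by rw [← hV, hVZ, ratModel_C_C]
    have h4 : V = C (C ((v : ℚ)⁻¹ * e)) := by
      have hv' : (v : ℚ) ≠ 0 := by exact_mod_cast hv
      calc V = C (C (v : ℚ)⁻¹) * (C (C (v : ℚ)) * V) := by rw [← mul_assoc, ← C_mul, ← C_mul, inv_mul_cancel₀ hv', C_1, C_1, one_mul]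
        _ = C (C ((v : ℚ)⁻¹ * e)) := by rw [h3, ← C_mul, ← C_mul]
    rw [h4]
    refine isUnit_C.2 (isUnit_C.2 (isUnit_iff_ne_zero.2 (mul_ne_zero (inv_ne_zero (by exact_mod_cast hv))
      (by exact_mod_cast he))))
  rcases hP.dvd_or_dvd hdvd with h | h
  · exact Or.inr (key hb hB hprod h)
  · exact Or.inl (key ha hA (by rw [mul_comm]; exact hprod) h)

/-- primality is symmetric in the two variables. -/
theorem prime_swap {P : ℤ[X][X]} (hP : Prime P) : Prime (Bivariate.swap P) :=
  (MulEquiv.prime_iff Bivariate.swap).2 hP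

/-- a function-field model exists for EVERY prime `P` of `Y`-degree `≥ 1` (GI not needed). -/
theorem siegelModel_nonempty_of_prime {P : ℤ[X][X]} (hP : Prime P) (hn : 1 ≤ P.natDegree) : Nonempty (SiegelModel P) :=
  curveModel_nonempty ℚ (irreducible_ratModel_of_prime hP hn) (by rw [natDegree_ratModel]; exact hn)

/-- **SIEGEL FUNCTIONS FOR EVERY PRIME** with `xdeg P, deg_Y P ≥ 1` (GI dropped). -/
theorem siegelFunctions_of_prime {P : ℤ[X][X]} (hP : Prime P) (hk : 1 ≤ xdeg P) (hn : 1 ≤ P.natDegree) :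
    SiegelFunctions P := by
  obtain ⟨M⟩ := siegelModel_nonempty_of_prime hP hn
  exact siegelFunctions_of_model hk hn M (degYBound P hk M) (fun a z hz ↦ integralDegreeBound M.F M.x (M.transcendental_x hn) a z hz)

/-- **THE HEIGHT COMPARISON FOR EVERY PRIME** `P` with `xdeg P, deg_Y P ≥ 1` — `GeomIrreducible` DROPPED:
`∀ ε > 0, ∃ c, |k·h(x) − n·h(y)| ≤ ε·h(x) + c` on the rational points of `P = 0`. -/
theorem heightComparisonAt_of_prime {P : ℤ[X][X]} (hP : Prime P) (hk : 1 ≤ xdeg P) (hn : 1 ≤ P.natDegree) :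
    HeightComparisonAt P :=
  heightComparisonAt_of_upper hn
    (upperComparisonAt_of_siegelFunctions (irreducible_ratModel_of_prime hP hn) (siegelFunctions_of_prime hP hk hn))
    (upperComparisonAt_of_siegelFunctions
      (irreducible_ratModel_of_prime (prime_swap hP) (by rw [natDegree_swap]; exact hk))
      (siegelFunctions_of_prime (prime_swap hP) (by rw [xdeg_swap]; exact hn) (by rw [natDegree_swap]; exact hk)))

/-- node 12's THEOREM A FOR EVERY PRIME: `deg_Y P < m₀ · xdeg P ⇒ ThinFibreAt m₀ P` (GI dropped). -/
theorem thinFibreAt_of_prime_lt {P : ℤ[X][X]} (hP : Prime P) {m₀ : ℕ} (hlt : P.natDegree < m₀ * xdeg P) :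
    ThinFibreAt m₀ P := by
  have hk : 1 ≤ xdeg P := by
    rcases Nat.eq_zero_or_pos (xdeg P) with h0 | h0
    · rw [h0, mul_zero] at hlt; exact absurd hlt (Nat.not_lt_zero _)
    · exact h0
  by_cases hn : P.natDegree = 0
  · have hm : 1 ≤ m₀ := by
      rcases Nat.eq_zero_or_pos m₀ with h0 | h0
      · rw [h0, zero_mul] at hlt; exact absurd hlt (Nat.not_lt_zero _)
      · exact h0
    exact thinFibreAt_of_natDegree_lt (by rw [hn]; exact hm)
  · exact thinFibreAt_of_heightComparisonAt (heightComparisonAt_of_prime hP hk (by omega)) hk hlt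

/-- [residual statement def] **Siegel's clause OFF the decided classes, OFF the subspace class and ABOVE-OR-ON THE
HEIGHT BOUNDARY**: demanded only for primes with `m₀ · xdeg P ≤ deg_Y P` — the GI proviso of `HeightOffAt` GONE
(`heightOffDegAt_of_heightOffAt`: implied by `HeightOffAt m₀`, strictly fewer instances). -/
def HeightOffDegAt (m₀ : ℕ) : Prop :=
  ∀ P : ℤ[X][X], Prime P → 2 ≤ P.natDegree → ¬ DecidedAt m₀ P → ¬ SepTopAt m₀ P → m₀ * xdeg P ≤ P.natDegree →
    SiegelClause P

/-- the new residual is WEAKER than the old: `HeightOffAt m₀ → HeightOffDegAt m₀`. -/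
theorem heightOffDegAt_of_heightOffAt {m₀ : ℕ} (h : HeightOffAt m₀) : HeightOffDegAt m₀ :=
  fun P hP hd hnd hns hle => h P hP hd hnd hns fun hH => absurd hH.2 (not_lt.2 hle)

/-- **THE K-LINE SECTOR HEAD, binder discharged AND GI dropped**: `PadicSubspace ∧ HeightOffDegAt m₀ ⇒ ThinFibre m₀`
(`m₀ ≥ 2`). -/
theorem thinFibre_of_padicSubspace_offDeg {m₀ : ℕ} (hm : 2 ≤ m₀) (hS : PadicSubspace) (hR : HeightOffDegAt m₀) :
    ThinFibre m₀ := by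
  refine thinFibre_of_prime hm fun P hP hd => ?_
  by_cases h : DecidedAt m₀ P
  · exact thinFibreAt_of_decidedAt hm hP.ne_zero h
  by_cases h' : SepTopAt m₀ P
  · exact thinFibreAt_of_sepTopAt hS hm h'
  rcases Nat.lt_or_ge P.natDegree (m₀ * xdeg P) with hlt | hle
  · exact thinFibreAt_of_prime_lt hP hlt
  · exact thinFibreAt_of_levelFinite (levelFinite_of_siegelClause (hR P hP hd h h' hle)) m₀

/-- … and its (b)-form. -/
theorem b_of_padicSubspace_offDeg {m₀ : ℕ} (hm : 2 ≤ m₀) (hS : PadicSubspace) (hR : HeightOffDegAt m₀) (ρ : ℝ)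
    (hρ : Summit.Schanuel.Schanuel.Theorems.RootDecomp1KSkelCell.SkelLiouvilleFix m₀ ρ) :
    AlgebraicIndependent ℚ ![((liouvilleNumber 2 : ℝ) : ℂ), (ρ : ℂ)] :=
  Summit.Schanuel.Schanuel.Theorems.RootDecomp1KDegreeLadder.thinFibre_imp_b (by omega)
    (thinFibre_of_padicSubspace_offDeg hm hS hR) ρ hρ

end PrimeAll

end Summit.Schanuel.Schanuel.Theorems.RootDecomp1KSiegelFunctions

end
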